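import Summits.ResolutionOfSingularities.ResolutionOfSingularities.Theorems.EquisingularLiftEquisingularLiftNatIsoHypPointOfPointBlowup
import Summits.ResolutionOfSingularities.ResolutionOfSingularities.Theorems.EquisingularLiftEquisingularLiftNatPointBlowupLocality
import HarnessLib

/-!
# [OURS] ★★★ FINITELY MANY ONE-STEP SINGULAR POINTS, IN ANY POSITION ⟹ the lead's hypothesis #7 `IsoHypPoint` (= `PointResolvable`)
# (cruxes `Theses.EquisingularLift.EquisingularLiftNat` / `…NatThree`, stmt-ResolutionOfSingularities-20038 / -20148)

[OURS · leafhand-res-equisingularlift-10 g0, 2026-08-31; cell `pub/decomp-res`] AI-produced, weaker than expert review; NOT a statement of any manuscript; nothing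
here proves resolution of singularities in positive characteristic.  DEF-FREE helper; no `sorry`; standard axioms; ZERO named hypotheses.

The one-generation hands 7–9 proved EL♮ for hypersurfaces whose singular points are one-step / first-order points AT COORDINATE VERTICES — at most `n + 1`
points «in linearly general position» — because seat res-D-pv-013's one-step engine blows up ONE product centre of `O`-points.  The lead's chain does not
need that: hypothesis #7 `IsoHypPoint` of the registered isolated residual stub is the DOWNSTAIRS point chain, lifted by T-ISO-0 / T-ISO-2 one point at a
time.  With the locality brick ✓ `PointChain.oneStepAt_of_isIso_morphismRestrict` and the induction ✓ `PointChain.chain_of_oneStepPoints`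
(…NatPointBlowupLocality) this file removes the general-position / cardinality restriction:

* ★★★ `isoHypPoint_of_oneStepPoints` — **ABSTRACT, ANY NUMBER OF POINTS, ANY POSITION**: `H` integral, `ι : H ↪ ℙⁿ_k̄` a closed immersion, `S` a
  finite set of points of `H` with closed images, `H` regular exactly off `S`, every `x ∈ S` ONE-STEP in the intrinsic sense «every blow-up of `H` at the
  reduced point `x` is regular at its points over `x`», and a point `ξ ∈ H` off `S` ⟹ `IsoHypPoint k n H ι`;
* `oneStepAt_vertex` — the intrinsic one-step property at the point of `V₊(F)` over a coordinate vertex `P_c` carrying seat res-D-pv-013's ONE-STEP datum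
  (✓ `OneStep.isRegularLocalRing_stalk_of_isBlowup_comap`; the vertex ideal `Λ_c` is the reduced point, ✓ `subsingleton_projectiveSpace_zero`);
* ★★ `isoHypPoint_of_oneStepVertices` — **EXPLICIT**: a prime form `F` over `K = K̄` whose singular points are one-step vertices `P_c`, `c ∈ S` (`S` ANY
  duplicate-free list of coordinates; charts `c ∉ S` regular; `V₊(F)` non-regular over each `P_c`) ⟹ `IsoHypPoint K (m+2) V₊(F) ι` — the by-name form, for
  the registered residual stub, of ✓ `OneStep.elNatAt_oneStepPoints` / ✓ `FirstOrderPoint.elNatAt_firstOrderPoints` (hands 7–9, seat res-D-pv-013).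

EXACT REMAINING BRICK for the explicit arbitrary-position statement «all singular points of `V₊(F)` are one-step points, each in its own linear coordinate
system»: the transport of the intrinsic one-step property along `V₊(F) ≅ V₊(F ∘ g)` (`g ∈ GL_{m+3}(K)`) at a point — ✓ `PointChain.oneStepAt_of_iso` reduces it
to naming that isomorphism on points (tree: `LinAutTransport`, `range_comp_projectiveSpaceLinAut`); S-sized, not done here.

Honest label: closes no registered stub (the registered isolated residual already carries `¬ IsoHypPoint`; these theorems certify which `H` that excludes).

References: [StacksProject, Tags 080E, 02OS]; [Hartshorne1977, I Thm. 5.1, II Ex. 7.12]; [Liu2002, §8.1] — through the cited tree files.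
-/

set_option linter.dupNamespace false -- mandated namespace `Summit.<Summit>.<Problem>` of this single-conjunct summit

noncomputable section

open CategoryTheory CategoryTheory.Limits AlgebraicGeometry TopologicalSpace
open Literature.AlgebraicGeometry.Resolution Literature.AlgebraicGeometry.Motives
open AlgebraicGeometry.Scheme.IdealSheafData

namespace Summit.ResolutionOfSingularities.ResolutionOfSingularities.Cruxes.EquisingularLiftNat.Sections

/-! ## The abstract theorem -/

/-- ★★★ **FINITELY MANY ONE-STEP SINGULAR POINTS, IN ANY POSITION ⟹ `IsoHypPoint`** (the lead's hypothesis #7 = `PointResolvable`).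
`k` algebraically closed, `H` integral, `ι : H ↪ ℙⁿ_k` a closed immersion; `S` a finite set of points of `H` with closed images such that
`H` is regular exactly off `S`, and every `x ∈ S` is a ONE-STEP point in the intrinsic sense «every blow-up of `H` at the reduced point `x` is
regular at its points over `x`»; `ξ ∈ H` a point off `S` (e.g. the generic point).  Then `IsoHypPoint k n H ι`: the downstairs chain blows
up the points of `S` ONE AT A TIME (`PointChain.chain_of_oneStepPoints`), in any order; no general-position hypothesis, any number of points.
[OURS] [cite: StacksProject, Tag 080E] [cite: Hartshorne1977, II Ex. 7.12] -/
theorem isoHypPoint_of_oneStepPoints (k : Type) [Field k] [IsAlgClosed k] (n : ℕ) (H : Scheme.{0})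
    (ι : H ⟶ (projectiveSpace n k).left) [IsClosedImmersion ι] [IsIntegral H]
    (S : Finset H)
    (hcl : ∀ x ∈ S, IsClosed ({ι x} : Set (projectiveSpace n k).left))
    (hsing : ∀ x ∈ S, ¬ IsRegularLocalRing (H.presheaf.stalk x))
    (hreg : ∀ x : H, x ∉ S → IsRegularLocalRing (H.presheaf.stalk x))
    (hone : ∀ x ∈ S, ∀ (hx : IsClosed ({x} : Set H)) (Z : Scheme.{0}) (τ : Z ⟶ H),
      IsBlowup τ (vanishingIdeal ⟨{x}, hx⟩) → ∀ z : Z, τ z = x → IsRegularLocalRing (Z.presheaf.stalk z))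
    (ξ : H) (hξ : ∀ x ∈ S, x ≠ ξ) :
    IsoHypPoint k n H ι := by
  classical
  haveI : IsLocallyNoetherian (projectiveSpace n k).left :=
    AlgebraicGeometry.LocallyOfFiniteType.isLocallyNoetherian (projectiveSpace n k).hom
  have hιinj : Function.Injective ι := ι.isClosedEmbedding.injective
  have hirr : IsIrreducible (Set.range ι) := by
    have h := (IrreducibleSpace.isIrreducible_univ H).image ι ι.continuous.continuousOn
    rwa [Set.image_univ] at h
  -- `H ≅ V(closure ι(H))_red`, compatibly with the embeddings
  let TD : Closeds (projectiveSpace n k).left := ⟨closure (Set.range ι), isClosed_closure⟩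
  have hDker : vanishingIdeal TD = ι.ker := by
    rw [← Scheme.IdealSheafData.map_bot, ← Scheme.nilradical_eq_bot, ← Scheme.IdealSheafData.vanishingIdeal_top,
      Scheme.IdealSheafData.map_vanishingIdeal]
    congr 1
    ext1
    change closure (Set.range ι) = closure (ι '' Set.univ)
    rw [Set.image_univ]
  have hkerD : (vanishingIdeal TD).subschemeι.ker = ι.ker := by
    rw [Scheme.IdealSheafData.ker_subschemeι, hDker]
  let eD : H ⟶ (vanishingIdeal TD).subscheme := IsClosedImmersion.lift _ ι hkerD.le
  have heD : eD ≫ (vanishingIdeal TD).subschemeι = ι := IsClosedImmersion.lift_fac _ ι hkerD.le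
  haveI : IsIso eD := IsClosedImmersion.isIso_lift _ ι hkerD
  have heD_apply : ∀ x : H, (vanishingIdeal TD).subschemeι (eD x) = ι x := fun x => by rw [← Scheme.Hom.comp_apply, heD]
  have heDinj : Function.Injective eD := (Scheme.homeoOfIso (asIso eD)).injective
  have heDsurj : Function.Surjective eD := (Scheme.homeoOfIso (asIso eD)).surjective
  -- transfer the hypotheses to `V(closure ι(H))_red`
  let S' : Finset ↥(vanishingIdeal TD).subscheme := S.image eD
  have hmemS' : ∀ x', x' ∈ S' → ∃ x ∈ S, eD x = x' := fun x' hx' => by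
    obtain ⟨x, hx, h⟩ := Finset.mem_image.mp hx'
    exact ⟨x, hx, h⟩
  have hcard : S'.card = S.card := Finset.card_image_of_injective _ heDinj
  have hξC : ι ξ ∈ (TD : Set (projectiveSpace n k).left) := subset_closure ⟨ξ, rfl⟩
  have hξS : ∀ x' ∈ S', ((vanishingIdeal TD).subschemeι x' : (projectiveSpace n k).left) ≠ ι ξ := by
    intro x' hx' h
    obtain ⟨x, hxS, rfl⟩ := hmemS' x' hx'
    rw [heD_apply] at h
    exact hξ x hxS (hιinj h)
  have hreg' : ∀ x' : ↥(vanishingIdeal TD).subscheme, x' ∉ S' →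
      IsRegularLocalRing (((vanishingIdeal TD).subscheme).presheaf.stalk x') := by
    intro x' hx'
    obtain ⟨x, rfl⟩ := heDsurj x'
    have hxS : x ∉ S := fun h => hx' (Finset.mem_image_of_mem eD h)
    haveI := hreg x hxS
    exact IsRegularLocalRing.of_ringEquiv (R := H.presheaf.stalk x) (asIso (eD.stalkMap x)).commRingCatIsoToRingEquiv.symm
  have hcl' : ∀ x' ∈ S', IsClosed ({((vanishingIdeal TD).subschemeι x' : (projectiveSpace n k).left)} : Set (projectiveSpace n k).left) := by
    intro x' hx'
    obtain ⟨x, hxS, rfl⟩ := hmemS' x' hx'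
    rw [heD_apply]; exact hcl x hxS
  have hsing' : ∀ x' ∈ S', ¬ IsRegularLocalRing (((vanishingIdeal TD).subscheme).presheaf.stalk x') := by
    intro x' hx' h
    obtain ⟨x, hxS, rfl⟩ := hmemS' x' hx'
    apply hsing x hxS
    haveI := h
    exact IsRegularLocalRing.of_ringEquiv (R := ((vanishingIdeal TD).subscheme).presheaf.stalk (eD x))
      (asIso (eD.stalkMap x)).commRingCatIsoToRingEquiv
  have hone' : ∀ x' ∈ S', ∀ (hx' : IsClosed ({x'} : Set ↥(vanishingIdeal TD).subscheme)) (Z : Scheme.{0})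
      (τ : Z ⟶ (vanishingIdeal TD).subscheme), IsBlowup τ (vanishingIdeal ⟨{x'}, hx'⟩) →
      ∀ z : Z, τ z = x' → IsRegularLocalRing (Z.presheaf.stalk z) := by
    intro x' hx'S hx' Z τ hτ z hz
    obtain ⟨x, hxS, rfl⟩ := hmemS' x' hx'S
    have hxcl : IsClosed ({x} : Set H) := PointChain.isClosed_singleton_of_injective ι hιinj (hcl x hxS)
    exact PointChain.oneStepAt_of_iso (asIso eD) hxcl (hone x hxS hxcl) hx' Z τ hτ z hz
  obtain ⟨F', ρ', T', hF', hreg''⟩ := PointChain.chain_of_oneStepPoints (P := (projectiveSpace n k).left) S.card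
    (projectiveSpace n k).left (𝟙 _) (Set.range ι) ι.isClosedEmbedding.isClosed_range hirr TD rfl S' hcard (ι ξ) hξC hξS
    hreg' hcl' hsing' hone'
  exact ⟨F', ρ', T', fun Q h0 hstep => hF' Q hstep h0, hreg''⟩




/-! ## Explicit: several one-step singular points at coordinate vertices -/

section Vertex

open MvPolynomial HomogeneousLocalization
open Literature.AlgebraicGeometry.Motives.SmoothHypersurface Literature.AlgebraicGeometry.Motives.ProjectiveSpace
open Summit.ResolutionOfSingularities.ResolutionOfSingularities.Cruxes.EquisingularLift.StrataSplit

/-- **The vertex ideal is the reduced point and its support is one point of `V₊(F)`** — bookkeeping shared by the vertex statements: for the kill map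
`f^{(c)}` of the vertex `P_c` and a prime form `F` whose vertex chart splits as `Φ + Ψ` (`μ ≥ 1`), there is a point `x₀ ∈ V₊(F)` with
`supp Λ_c = {ι x₀}`, `Λ_c = vanishingIdeal {ι x₀}`, and `Λ_c·𝒪 = vanishingIdeal {x₀}`. [OURS] [folklore] -/
theorem exists_vertexPoint (K : Type) [Field K] {m : ℕ} (F : MvPolynomial (Fin (m + 2 + 1)) K) {d : ℕ} (hF : F.IsHomogeneous d)
    (c : Fin (m + 2 + 1))
    (hsplit : ∃ (μ : ℕ) (Φ Ψ : MvPolynomial (Fin (m + 2)) K), 1 ≤ μ ∧ Φ.IsHomogeneous μ ∧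
      Ψ ∈ Ideal.span (Set.range (X : Fin (m + 2) → MvPolynomial (Fin (m + 2)) K)) ^ (μ + 1) ∧ ProjectiveSpace.dehomogenize K c F = Φ + Ψ) :
    letI := MvPolynomial.gradedAlgebra (σ := Fin (m + 2 + 1)) (R := K)
    letI := MvPolynomial.gradedAlgebra (σ := Fin (0 + 1)) (R := K)
    ∀ (fk : homogeneousSubmodule (Fin (m + 2 + 1)) K →+*ᵍ homogeneousSubmodule (Fin (0 + 1)) K)
      (hfk' : HomogeneousIdeal.irrelevant (homogeneousSubmodule (Fin (0 + 1)) K) ≤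
        (HomogeneousIdeal.irrelevant (homogeneousSubmodule (Fin (m + 2 + 1)) K)).map fk)
      (_ : ∀ a : K, fk (C a) = C a) (_ : ∀ j : Fin 1, fk (X c) = X j) (_ : ∀ i : Fin (m + 2 + 1), i ≠ c → fk (X i) = 0),
      ∃ (x₀ : ↥(hypersurface F).left) (hx₀cl : IsClosed ({(hypersurfaceι F).left x₀} : Set (Proj (homogeneousSubmodule (Fin (m + 2 + 1)) K))))
        (hx₀cl' : IsClosed ({x₀} : Set ↥(hypersurface F).left)),
        ((Proj.map fk hfk').ker.support : Set (Proj (homogeneousSubmodule (Fin (m + 2 + 1)) K))) = {(hypersurfaceι F).left x₀} ∧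
        (∀ a : Fin (m + 2 + 1), a ≠ c → (X a : MvPolynomial (Fin (m + 2 + 1)) K) ∈ ((hypersurfaceι F).left x₀).asHomogeneousIdeal) ∧
        vanishingIdeal ⟨{(hypersurfaceι F).left x₀}, hx₀cl⟩ = (Proj.map fk hfk').ker ∧
        ((Proj.map fk hfk').ker).comap (hypersurfaceι F).left = vanishingIdeal ⟨{x₀}, hx₀cl'⟩ := by
  letI := MvPolynomial.gradedAlgebra (σ := Fin (m + 2 + 1)) (R := K)
  letI := MvPolynomial.gradedAlgebra (σ := Fin (0 + 1)) (R := K)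
  intro fk hfk' hfkC hfke hfk0
  have he : Function.Injective (fun _ : Fin 1 => c) := Function.injective_of_subsingleton _
  have hfkeR : ∀ j : Fin 1, fk (X ((fun _ : Fin 1 => c) j)) = X j := fun j => hfke j
  have hfk0R : ∀ i : Fin (m + 2 + 1), i ∉ Set.range (fun _ : Fin 1 => c) → fk (X i) = 0 := fun i hi => hfk0 i (fun h => hi ⟨0, h.symm⟩)
  have hιinj : Function.Injective (hypersurfaceι F).left := (hypersurfaceι F).left.isClosedEmbedding.injective
  -- a point of the support, on `V₊(F)`
  have hne : ((Proj.map fk hfk').ker.support : Set (Proj (homogeneousSubmodule (Fin (m + 2 + 1)) K))).Nonempty := by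
    rw [LinearCentre.support_ker_eq_range (fun _ : Fin 1 => c) fk hfk' hfkC hfkeR]
    exact ⟨_, ⟨Literature.AlgebraicGeometry.Motives.coordSubspacePoint (k := K) (N := 0) ∅ (by simp), rfl⟩⟩
  obtain ⟨v, hv⟩ := hne
  have hvX : ∀ a : Fin (m + 2 + 1), a ≠ c → (X a : MvPolynomial (Fin (m + 2 + 1)) K) ∈ v.asHomogeneousIdeal := fun a ha =>
    LinearCentre.X_mem_asHomogeneousIdeal_of_mem_support (fun _ : Fin 1 => c) fk hfk' hfkC hfkeR hfk0R hv (fun ⟨_, hj⟩ => ha hj.symm)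
  have hvrange : v ∈ Set.range (hypersurfaceι F).left := by
    obtain ⟨μ, Φ, Ψ, hμ, hΦ, hΨ, hdeh⟩ := hsplit
    refine (Set.ext_iff.mp (range_hypersurfaceι F) v).mpr ((ProjectiveSpectrum.mem_zeroLocus _ _ _).mpr (Set.singleton_subset_iff.mpr ?_))
    change F ∈ v.asHomogeneousIdeal
    exact (Ideal.span_le.mpr (Set.range_subset_iff.mpr fun j => hvX _ (Fin.succAbove_ne c j)))
      (OrdPointAt.mem_span_X_succAbove K F c hF Φ Ψ hΦ hμ hΨ hdeh)
  obtain ⟨x₀, hx₀v⟩ := hvrange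
  -- the support is `{ι x₀}`
  have hsupp : ((Proj.map fk hfk').ker.support : Set (Proj (homogeneousSubmodule (Fin (m + 2 + 1)) K))) = {(hypersurfaceι F).left x₀} := by
    refine Set.Subsingleton.eq_singleton_of_mem ?_ (by rw [hx₀v]; exact hv)
    rw [LinearCentre.support_ker_eq_range (fun _ : Fin 1 => c) fk hfk' hfkC hfkeR]
    haveI : Subsingleton ↥(Proj (homogeneousSubmodule (Fin (0 + 1)) K)) := subsingleton_projectiveSpace_zero K
    rintro _ ⟨i, rfl⟩ _ ⟨j, rfl⟩
    rw [Subsingleton.elim i j]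
  have hx₀cl : IsClosed ({(hypersurfaceι F).left x₀} : Set (Proj (homogeneousSubmodule (Fin (m + 2 + 1)) K))) := by
    rw [← hsupp]; exact (Proj.map fk hfk').ker.support.isClosed
  have hx₀cl' : IsClosed ({x₀} : Set ↥(hypersurface F).left) := PointChain.isClosed_singleton_of_injective _ hιinj hx₀cl
  -- the vertex ideal is the reduced point
  have hΛ : vanishingIdeal ⟨{(hypersurfaceι F).left x₀}, hx₀cl⟩ = (Proj.map fk hfk').ker := by
    haveI : IsClosedImmersion (Proj.map fk hfk') := LinearCentre.isClosedImmersion_projMap_kill (fun _ : Fin 1 => c) fk hfk' hfkC hfkeR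
    haveI : IsReduced (Proj (homogeneousSubmodule (Fin (0 + 1)) K)) := inferInstanceAs (IsReduced (projectiveSpace 0 K).left)
    rw [← Scheme.IdealSheafData.map_bot, ← Scheme.nilradical_eq_bot, ← Scheme.IdealSheafData.vanishingIdeal_top,
      Scheme.IdealSheafData.map_vanishingIdeal]
    congr 1
    ext1
    change ({(hypersurfaceι F).left x₀} : Set (Proj (homogeneousSubmodule (Fin (m + 2 + 1)) K))) =
      closure ((Proj.map fk hfk') '' ((⊤ : Closeds (Proj (homogeneousSubmodule (Fin (0 + 1)) K))) : Set _))
    rw [Closeds.coe_top, Set.image_univ, ← LinearCentre.support_ker_eq_range (fun _ : Fin 1 => c) fk hfk' hfkC hfkeR, hsupp, hx₀cl.closure_eq]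
  refine ⟨x₀, hx₀cl, hx₀cl', hsupp, fun a ha => by rw [hx₀v]; exact hvX a ha, hΛ, ?_⟩
  rw [← hΛ]
  have hC : (⟨{(hypersurfaceι F).left x₀}, hx₀cl⟩ : Closeds _) =
      ⟨(hypersurfaceι F).left '' (({x₀} : Set ↥(hypersurface F).left)), (hypersurfaceι F).left.isClosedEmbedding.isClosedMap _ hx₀cl'⟩ :=
    Closeds.ext Set.image_singleton.symm
  exact (congrArg (fun C : Closeds _ => (vanishingIdeal C).comap (hypersurfaceι F).left) hC).trans
    (comap_vanishingIdeal_image_of_isClosedImmersion (hypersurfaceι F).left ⟨{x₀}, hx₀cl'⟩)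

/-- ★★ **SEVERAL ONE-STEP SINGULAR VERTICES ⟹ `IsoHypPoint`** — every dimension, every characteristic, ANY duplicate-free list `S` of coordinates (no
cardinality, general-position or duplicate-freeness proviso beyond being vertices).  `K` algebraically closed; `F ∈ K[x₀,…,x_{m+2}]` a prime form; for `c ∈ S` the vertex chart
`F(x_c := 1) = Φ + Ψ` (`Φ ≠ 0` a form of degree `μ ≥ 1`, `Ψ ∈ (y)^{μ+1}`) with explicit strict transforms `G_l` passing the Jacobian criterion at the primes
containing `T_l` (seat res-D-pv-013's ONE-STEP datum), singular at most at the origin, and `V₊(F)` NON-REGULAR over `P_c`; the charts `c ∉ S` regular.  Then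
`IsoHypPoint K (m+2) V₊(F) ι` (the lead's hypothesis #7; = `PointResolvable`): the downstairs chain blows up the vertices one at a time
(✓ `isoHypPoint_of_oneStepPoints`; pointwise regularity over each vertex by ✓ `OneStep.isRegularLocalRing_stalk_of_isBlowup_comap`; regularity off the vertices by
✓ `MultiOrd.isRegularLocalRing_stalk_of_forall_exists`). [OURS] [cite: Hartshorne1977, I Thm. 5.1] [cite: StacksProject, Tag 080E] -/
theorem isoHypPoint_of_oneStepVertices (K : Type) [Field K] [IsAlgClosed K] {m : ℕ}
    (F : MvPolynomial (Fin (m + 2 + 1)) K) {d : ℕ} (hF : F.IsHomogeneous d) (hFp : Prime F)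
    (S : List (Fin (m + 2 + 1)))
    (hone : ∀ c ∈ S, ∃ (μ : ℕ) (Φ Ψ : MvPolynomial (Fin (m + 2)) K), 1 ≤ μ ∧ Φ.IsHomogeneous μ ∧ Φ ≠ 0 ∧
      Ψ ∈ Ideal.span (Set.range (X : Fin (m + 2) → MvPolynomial (Fin (m + 2)) K)) ^ (μ + 1) ∧ ProjectiveSpace.dehomogenize K c F = Φ + Ψ ∧
      ∀ l : Fin (m + 2), ∃ G : MvPolynomial (Fin (m + 2)) K,
        aeval (fun j => X l * Function.update (X : Fin (m + 2) → MvPolynomial (Fin (m + 2)) K) l 1 j) (Φ + Ψ) = X l ^ μ * G ∧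
        ∀ P : Ideal (MvPolynomial (Fin (m + 2)) K), P.IsPrime → (X l : MvPolynomial (Fin (m + 2)) K) ∈ P → G ∈ P → ∃ j, pderiv j G ∉ P)
    (hsing : ∀ c ∈ S, ∀ P : Ideal (MvPolynomial (Fin (m + 2)) K), P.IsPrime → ProjectiveSpace.dehomogenize K c F ∈ P →
      (∀ j, pderiv j (ProjectiveSpace.dehomogenize K c F) ∈ P) → ∀ j, (X j : MvPolynomial (Fin (m + 2)) K) ∈ P)
    (hsingpt : letI := MvPolynomial.gradedAlgebra (σ := Fin (m + 2 + 1)) (R := K)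
      ∀ c ∈ S, ∀ x : ↥(hypersurface F).left, (∀ a : Fin (m + 2 + 1), a ≠ c →
        (X a : MvPolynomial (Fin (m + 2 + 1)) K) ∈ ((hypersurfaceι F).left x).asHomogeneousIdeal) →
        ¬ IsRegularLocalRing ((hypersurface F).left.presheaf.stalk x))
    (hoff : letI := MvPolynomial.gradedAlgebra (σ := Fin (m + 2 + 1)) (R := K)
      ∀ c, c ∉ S → IsRegularRing (ChartRing F c hF)) :
    letI := MvPolynomial.gradedAlgebra (σ := Fin (m + 2 + 1)) (R := K)
    IsoHypPoint K (m + 2) (hypersurface F).left (hypersurfaceι F).left := by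
  letI := MvPolynomial.gradedAlgebra (σ := Fin (m + 2 + 1)) (R := K)
  letI := MvPolynomial.gradedAlgebra (σ := Fin (0 + 1)) (R := K)
  classical
  haveI := HypersurfaceSpecimen.isIntegral_hypersurface_of_prime K F hF hFp
  have hd : 0 < d := ConeN.pos_of_prime_of_isHomogeneous K F hF hFp
  have hιinj : Function.Injective (hypersurfaceι F).left := (hypersurfaceι F).left.isClosedEmbedding.injective
  have he : ∀ c : Fin (m + 2 + 1), Function.Injective (fun _ : Fin 1 => c) := fun c => Function.injective_of_subsingleton _
  have hec : ∀ c : Fin (m + 2 + 1), ∀ j : Fin 1, (fun _ : Fin 1 => c) j = c := fun _ _ => rfl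
  have hexk : ∀ c : Fin (m + 2 + 1), ∃ (g : homogeneousSubmodule (Fin (m + 2 + 1)) K →+*ᵍ homogeneousSubmodule (Fin (0 + 1)) K)
      (_ : HomogeneousIdeal.irrelevant (homogeneousSubmodule (Fin (0 + 1)) K) ≤
        (HomogeneousIdeal.irrelevant (homogeneousSubmodule (Fin (m + 2 + 1)) K)).map g),
      (∀ a : K, g (C a) = C a) ∧ (∀ j : Fin 1, g (X ((fun _ : Fin 1 => c) j)) = X j) ∧
        (∀ i : Fin (m + 2 + 1), i ∉ Set.range (fun _ : Fin 1 => c) → g (X i) = 0) := fun c =>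
    LinearCentre.exists_kill (R := K) (fun _ : Fin 1 => c) (he c)
  choose fk hfk' hfkC hfke hfk0 using hexk
  have hfke' : ∀ c (j : Fin 1), fk c (X c) = X j := fun c j => hfke c j
  have hfk0' : ∀ c (i : Fin (m + 2 + 1)), i ≠ c → fk c (X i) = 0 := fun c i hi => hfk0 c i (fun ⟨_, hj⟩ => hi hj.symm)
  -- the vertex points of `V₊(F)`, `c ∈ S`
  have hvert : ∀ c, c ∈ S → ∃ (x₀ : ↥(hypersurface F).left)
      (hx₀cl : IsClosed ({(hypersurfaceι F).left x₀} : Set (Proj (homogeneousSubmodule (Fin (m + 2 + 1)) K))))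
      (hx₀cl' : IsClosed ({x₀} : Set ↥(hypersurface F).left)),
      ((Proj.map (fk c) (hfk' c)).ker.support : Set (Proj (homogeneousSubmodule (Fin (m + 2 + 1)) K))) = {(hypersurfaceι F).left x₀} ∧
      (∀ a : Fin (m + 2 + 1), a ≠ c → (X a : MvPolynomial (Fin (m + 2 + 1)) K) ∈ ((hypersurfaceι F).left x₀).asHomogeneousIdeal) ∧
      vanishingIdeal ⟨{(hypersurfaceι F).left x₀}, hx₀cl⟩ = (Proj.map (fk c) (hfk' c)).ker ∧
      ((Proj.map (fk c) (hfk' c)).ker).comap (hypersurfaceι F).left = vanishingIdeal ⟨{x₀}, hx₀cl'⟩ := by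
    intro c hc
    obtain ⟨μ, Φ, Ψ, hμ, hΦ, -, hΨ, hdeh, -⟩ := hone c hc
    exact exists_vertexPoint K F hF c ⟨μ, Φ, Ψ, hμ, hΦ, hΨ, hdeh⟩ (fk c) (hfk' c) (hfkC c) (hfke' c) (hfk0' c)
  choose xpt hxcl hxcl' hxsupp hxX hxΛ hxcomap using hvert
  -- the finite set of singular points
  let SH : Finset ↥(hypersurface F).left := S.toFinset.attach.image (fun c => xpt c.1 (List.mem_toFinset.mp c.2))
  have hmemSH : ∀ x, x ∈ SH → ∃ (c : Fin (m + 2 + 1)) (hc : c ∈ S), xpt c hc = x := fun x hx => by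
    obtain ⟨c, -, h⟩ := Finset.mem_image.mp hx
    exact ⟨c.1, List.mem_toFinset.mp c.2, h⟩
  have hmemSH' : ∀ (c : Fin (m + 2 + 1)) (hc : c ∈ S), xpt c hc ∈ SH := fun c hc =>
    Finset.mem_image.mpr ⟨⟨c, List.mem_toFinset.mpr hc⟩, Finset.mem_attach _ _, rfl⟩
  -- the generic point
  obtain ⟨ξ, hξ⟩ : ∃ ξ : ↥(hypersurface F).left, (hypersurfaceι F).left ξ = pointOfPrime F hF hFp := by
    have h : (pointOfPrime F hF hFp : Proj (homogeneousSubmodule (Fin (m + 2 + 1)) K)) ∈ Set.range (hypersurfaceι F).left := by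
      refine (Set.ext_iff.mp (range_hypersurfaceι F) _).mpr ((ProjectiveSpectrum.mem_zeroLocus _ _ _).mpr (Set.singleton_subset_iff.mpr ?_))
      exact Ideal.subset_span rfl
    exact h
  refine isoHypPoint_of_oneStepPoints K (m + 2) (hypersurface F).left (hypersurfaceι F).left SH ?_ ?_ ?_ ?_ ξ ?_
  · -- closed images
    intro x hx
    obtain ⟨c, hc, rfl⟩ := hmemSH x hx
    exact hxcl c hc
  · -- non-regular
    intro x hx
    obtain ⟨c, hc, rfl⟩ := hmemSH x hx
    exact hsingpt c hc _ (hxX c hc)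
  · -- regular off the vertices
    intro x hx
    have hrad : ∀ c ∈ S, (Ideal.span {ProjectiveSpace.dehomogenize K c F}).radical = Ideal.span {ProjectiveSpace.dehomogenize K c F} := by
      intro c hc
      obtain ⟨μ, Φ, Ψ, hμ, hΦ, -, hΨ, hdeh, -⟩ := hone c hc
      rw [hdeh]
      exact OrdPointAt.radical_span_dehomogenize_eq K F c hF hFp Φ Ψ hΦ hμ hΨ hdeh
    refine MultiOrd.isRegularLocalRing_stalk_of_forall_exists K F hF hd S (fun c hc => ⟨hrad c hc, hsing c hc⟩) hoff x (fun c hc => ?_)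
    have hxc : (hypersurfaceι F).left x ∉ ((Proj.map (fk c) (hfk' c)).ker.support : Set (Proj (homogeneousSubmodule (Fin (m + 2 + 1)) K))) := by
      rw [hxsupp c hc]
      intro h
      exact hx (by rw [hιinj (Set.mem_singleton_iff.mp h)]; exact hmemSH' c hc)
    obtain ⟨a, ha, hXa⟩ := LinearCentre.exists_X_not_mem_of_not_mem_support (fun _ : Fin 1 => c) (he c) (fk c) (hfk' c) (hfkC c) (hfke c)
      (hfk0 c) hxc
    exact ⟨a, (OrdPointAt.not_mem_range_iff c (hec c) a).mp ha, (Proj.mem_basicOpen _ _ _).mpr hXa⟩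
  · -- one-step, pointwise over each vertex
    intro x hx hxcl₀ Z τ hτ z hz
    obtain ⟨c, hc, rfl⟩ := hmemSH x hx
    obtain ⟨μ, Φ, Ψ, hμ, hΦ, hΦ0, hΨ, hdeh, hG⟩ := hone c hc
    have hτ' : IsBlowup τ (((Proj.map (fk c) (hfk' c)).ker).comap (hypersurfaceι F).left) := by rw [hxcomap c hc]; exact hτ
    refine OneStep.isRegularLocalRing_stalk_of_isBlowup_comap K F c hF hFp (hec c) (fk c) (hfk' c) (hfkC c) (hfke c) (hfk0 c)
      Φ Ψ hΦ hμ hΦ0 hΨ hdeh hG hτ' z ?_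
    have hgoal : (hypersurfaceι F).left (τ z) ∈ ((Proj.map (fk c) (hfk' c)).ker.support : Set (Proj (homogeneousSubmodule (Fin (m + 2 + 1)) K))) := by
      rw [hz, hxsupp c hc]; rfl
    rw [Scheme.IdealSheafData.support_comap]
    exact hgoal
  · -- the generic point is no vertex
    intro x hx h
    obtain ⟨c, hc, rfl⟩ := hmemSH x hx
    obtain ⟨a, hac, ha⟩ := MultiOrd.exists_X_ne_not_mem_span K F hFp c
    have hmem : (hypersurfaceι F).left ξ ∈ ((Proj.map (fk c) (hfk' c)).ker.support : Set (Proj (homogeneousSubmodule (Fin (m + 2 + 1)) K))) := by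
      rw [hxsupp c hc, ← h]; rfl
    rw [hξ] at hmem
    exact ha (CoordPoints.X_mem_of_mem_support fk hfk' hfkC hfke' hfk0' hmem hac)

end Vertex

end Summit.ResolutionOfSingularities.ResolutionOfSingularities.Cruxes.EquisingularLiftNat.Sections

end
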